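import Literature.AnabelianGeometry.EtaleTheta.Discharge.Sec3Thm37Cnst
import Literature.AnabelianGeometry.EtaleTheta.RealifiedDivisorMonoidsOfRlf
import HarnessLib

/-!
# [EtTh] Prop 3.4 (ii) relative to `D^cnst`: transport from the Def. 3.3 (iii) data to the Def. 3.6 (i)
# data of monoid type `ℤ` constructed from them (`RealifiedDivisorMonoids.ofRlfZ`) — PROVED

Proof-only companion (theorems only, no definitions) of `TemperedFrobenioidCnst.lean` v2 (abc-iut-L2-t3,
owner) in the series `Discharge/Sec3*.lean`.  S. Mochizuki, *The étale theta function …*, Publ. RIMS **45**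
(2009) [EtTh], §3, Proposition 3.4 (ii) p.74 and Definition 3.6 (i) p.76 (PDF) of
`paper:doi-10-2977-prims-1234361159` [cite: MochizukiEtTh2009, Prop 3.4 (ii) p.74]:

> "Then we have natural isomorphisms of monoids `O_L^× ⥲ Ker(B₀(Y^log) → Φ₀^gp(Y^log)) ⊆ B₀(Y^log)`;
> `O_L^▷ ⥲ B₀(Y^log) ×_{Φ₀^gp(Y^log)} Φ₀(Y^log)`; `L^× ⥲ F₀(Y^log) ⊆ B₀(Y^log)`"  and (Def. 3.6 (i))
> "`B₀^Λ` for `B₀` (resp. `B₀^pf`; `ℝ·Φ₀^birat`) if `Λ = ℤ` (resp. `ℚ`; `ℝ`), `F₀^Λ ⊆ B₀^Λ` for `F₀` …".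

For the Def. 3.6 (i) data of monoid type `ℤ` CONSTRUCTED from Def. 3.3 (iii) data `dm`
(`RealifiedDivisorMonoids.ofRlfZ dm hpf`, abc-iut-L6-t12: `Φ₀^ℝ := Φ₀^rlf`, `B₀^ℤ := B₀`, `F₀^ℤ := F₀`,
`B₀^ℤ → (Φ₀^ℝ)^gp := (Φ₀^gp → (Φ₀^rlf)^gp) ∘ (B₀ → Φ₀^gp)`), the Prop. 3.4 (ii) clauses relative to `D^cnst`
at monoid type `Λ` (`RealifiedDivisorMonoids.Prop34Cnst`, the hypothesis of Theorem 3.7 (iii) in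
`Discharge/Sec3Thm37Cnst.lean`) FOLLOW from the typed Prop. 3.4 (ii) at the `B₀`-level
(`DivisorMonoids.Prop34`: kernel / effective locus ⊆ constants) together with the `B₀`-level naturality
clauses (`DivisorMonoids.Prop34Cnst₀`).  The one non-formal step is monoid theory of the realification
of a perf-factorial monoid ([FrdI] Def. 2.4 (i)): **an element of `Φ₀(Y)^gp` whose image in
`(Φ₀(Y)^rlf)^gp` is EFFECTIVE (lies in `Φ₀(Y)^rlf`) is itself effective (lies in `Φ₀(Y)`)** —
`RlfEffective.exists_eq_of` below, from: `M^rlf` integral ([FrdI]; `IsPerfFactorial.Rlf.isIntegral`,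
abc-iut-L1), the order embedding `M^pf ↪ M^rlf` ([EtTh] Lemma 3.5 portion,
`RlfCoord.toRealification_dvd_iff`, abc-iut-L2-d2; `PerfectionPrimes.isMonoprime_pfAt`), injectivity of
`M → M^pf` and saturatedness of the divisorial monoid `M` ([FrdI] §0).

* `RlfEffective.exists_eq_of` — the monoid lemma;
* **`RealifiedDivisorMonoids.Prop34Cnst.ofRlfZ`** — `dm.Prop34 V V₀ → dm.Prop34Cnst₀ cnst →
  (ofRlfZ dm hpf).Prop34Cnst cnst`;
* `TemperedFrobenioid.thm37_iii_withCnst_ofRlfZ` — hence Theorem 3.7 (iii), as typed, for every tempered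
  Frobenioid over the CONSTRUCTED Def. 3.6 (i) data of monoid type `ℤ`, modulo `Prop34` + `Prop34Cnst₀`
  (statements about the Def. 3.3 (iii) data only);
* `Toy.prop34Cnst₀` — the `B₀`-level structure holds on the toy Def. 3.3 (iii) data (satisfiability).
HONEST FRAMING: refereed pre-IUT material; nothing here bears on [IUTchIII] Cor. 3.12; no statement of
the paper is strengthened; here PROVED.
-/

noncomputable section

namespace Literature.AnabelianGeometry.EtaleTheta

open CategoryTheory Opposite Literature.AlgebraicGeometry.Frobenioids

universe u₀ v₀ u₁ v₁ u v w

/-! ### Monoid theory: effectivity is detected in the realification -/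

namespace RlfEffective

variable {M : Type w} [CommMonoid M]

/-- **An element of `M^gp` whose image in `(M^rlf)^gp` is effective is effective**, for a
perf-factorial monoid `M` ([FrdI] Def. 2.4 (i)): if `g ∈ M^gp` maps to (the image of) `x ∈ M^rlf` under
`M^gp → (M^rlf)^gp`, then `g = [x₀]` for some `x₀ ∈ M`, and `x` is the image of `x₀`.  Proof: write
`g = a/c`; then `x · ι(c) = ι(a)` in `M^rlf` (`M^rlf` integral), so `ι(c) ≤ ι(a)` in `M^rlf`, hence
`c ≤ a` in `M^pf` (order embedding `M^pf ↪ M^rlf`), i.e. `a = c · d` with `d^n ∈ M` for some `n ≥ 1`;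
thus `g^n ∈ M` and `g ∈ M` as `M` is saturated. [cite: MochizukiFrdI2008, Def. 2.4(i) p.48] -/
theorem exists_eq_of (hP : IsPerfFactorial M) (g : Algebra.GrothendieckGroup M) (x : hP.Rlf)
    (h : gpMap (hP.toRealification.comp (Perfection.of M)) g = Algebra.GrothendieckGroup.of x) :
    ∃ x₀ : M, g = Algebra.GrothendieckGroup.of x₀ ∧ x = hP.toRealification (Perfection.of M x₀) := by
  -- `g = a / c`
  obtain ⟨a, c, hac⟩ := gp_exists_mul_of_eq_of g
  have hint : Function.Injective (Algebra.GrothendieckGroup.of (M := hP.Rlf)) :=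
    (IsPerfFactorial.Rlf.isIntegral hP).injective_of
  -- `x · ι(c) = ι(a)` in `M^rlf`
  have h1 : Algebra.GrothendieckGroup.of x *
      Algebra.GrothendieckGroup.of ((hP.toRealification.comp (Perfection.of M)) c) =
        Algebra.GrothendieckGroup.of ((hP.toRealification.comp (Perfection.of M)) a) := by
    have h' := congrArg (gpMap (hP.toRealification.comp (Perfection.of M))) hac
    rw [map_mul, gpMap_of, gpMap_of, h] at h'
    exact h'
  have h2 : x * (hP.toRealification.comp (Perfection.of M)) c =
      (hP.toRealification.comp (Perfection.of M)) a :=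
    hint (by rw [map_mul]; exact h1)
  -- `ι(c) ≤ ι(a)` in `M^rlf`, hence `c ≤ a` in `M^pf`
  have h3 : hP.toRealification (Perfection.of M c) ∣ hP.toRealification (Perfection.of M a) :=
    ⟨x, by rw [mul_comm]; exact h2.symm⟩
  have h4 : Perfection.of M c ∣ Perfection.of M a :=
    (RlfCoord.toRealification_dvd_iff hP (fun 𝔮 => PerfectionPrimes.isMonoprime_pfAt hP 𝔮) _ _).mp h3
  obtain ⟨d, hd⟩ := h4
  obtain ⟨⟨m, n⟩, hmn⟩ := Perfection.mk_surjective d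
  simp only at hmn
  subst hmn
  -- `a^n = c^n · m` in `M`
  have hofinj : Function.Injective (Perfection.of M) :=
    of_injective_of_isSharp_isIntegral_isSaturated hP.isDivisorial.isSharp
      hP.isDivisorial.isPreDivisorial.isIntegral hP.isDivisorial.isPreDivisorial.isSaturated
  have h5 : a ^ (n : ℕ) = c ^ (n : ℕ) * m := by
    apply hofinj
    rw [map_pow, hd, mul_pow, Perfection.mk_pow_self, map_mul, map_pow]
  -- `g^n = [m]` in `M^gp`
  have h6 : g ^ (n : ℕ) = Algebra.GrothendieckGroup.of m := by
    have h' := congrArg (fun y => y ^ (n : ℕ)) hac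
    rw [mul_pow, ← map_pow, ← map_pow, h5, map_mul,
      mul_comm (Algebra.GrothendieckGroup.of (c ^ (n : ℕ)))] at h'
    exact mul_right_cancel h'
  -- `M` saturated
  obtain ⟨x₀, hx₀⟩ :=
    hP.isDivisorial.isPreDivisorial.isSaturated.mem_range_of_pow_mem_range g n n.pos ⟨m, h6.symm⟩
  refine ⟨x₀, hx₀.symm, hint ?_⟩
  rw [← h, ← hx₀, gpMap_of]
  rfl

/-- In particular the image of `g` is trivial only if `g` is: `M^gp → (M^rlf)^gp` is injective on … —
here in the form used below: `[x₀]` maps to `[ι x₀]`. [cite: MochizukiFrdI2008, Def. 2.4(i) p.48] -/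
theorem gpMap_of_eq (hP : IsPerfFactorial M) (x₀ : M) :
    gpMap (hP.toRealification.comp (Perfection.of M)) (Algebra.GrothendieckGroup.of x₀) =
      Algebra.GrothendieckGroup.of (hP.toRealification (Perfection.of M x₀)) :=
  gpMap_of _ _

end RlfEffective

/-! ### The transport `Prop34 ∧ Prop34Cnst₀ ⇒ Prop34Cnst (ofRlfZ dm)` -/

namespace RealifiedDivisorMonoids.Prop34Cnst

variable {D₀ : Type u} [Category.{v} D₀] {dm : DivisorMonoids.{u, v, w} D₀}
  {hpf : ∀ Y : D₀ᵒᵖ, IsPerfFactorial (dm.Φ₀.obj Y)} {V : FrdIMonoidStub.{w}}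
  {V₀ : FrdICatStub.{u, v, w} D₀} {Dcnst : Type u₁} [Category.{v₁} Dcnst] {cnst : D₀ ⥤ Dcnst}

/-- **Prop. 3.4 (ii) relative to `D^cnst` for the constructed Def. 3.6 (i) data of monoid type `ℤ`**:
for `T = ofRlfZ dm hpf` (`B₀^ℤ = B₀`, `F₀^ℤ = F₀`, `Φ₀^ℝ = Φ₀^rlf`), the clauses `Prop34Cnst T cnst` follow
from the typed Prop. 3.4 (ii) at the `B₀`-level (`dm.Prop34`: effective locus ⊆ `F₀`) and the `B₀`-level
naturality clauses `dm.Prop34Cnst₀ cnst` — effectivity of the image in `(Φ₀^rlf)^gp` being detected in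
`Φ₀` (`RlfEffective.exists_eq_of`). [cite: MochizukiEtTh2009, Prop 3.4 (ii) p.74] -/
theorem ofRlfZ (h34 : dm.Prop34 V V₀) (h₀ : dm.Prop34Cnst₀ cnst) :
    (RealifiedDivisorMonoids.ofRlfZ dm hpf).Prop34Cnst cnst where
  mem_FΛ_of_divΛ_eq_of Y b x hbx := by
    obtain ⟨x₀, hx₀, -⟩ := RlfEffective.exists_eq_of (hpf Y) (dm.div₀ Y b) x hbx
    exact h34.mem_F₀_of_div₀_mem Y b x₀ hx₀
  BΛ_map_eq_of_cnst_map_eq g g' hg b hb := h₀.B₀_map_eq_of_cnst_map_eq g g' hg b hb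
  ΦR_map_eq_of_cnst_map_eq := by
    rintro Y Y' g g' hg x ⟨b, hb, hbx⟩
    obtain ⟨x₀, hx₀, rfl⟩ := RlfEffective.exists_eq_of (hpf (op Y')) (dm.div₀ (op Y') b) x hbx
    change rlfMap dm.Φ₀ hpf g.op ((hpf (op Y')).toRealification (Perfection.of _ x₀)) =
      rlfMap dm.Φ₀ hpf g'.op ((hpf (op Y')).toRealification (Perfection.of _ x₀))
    rw [rlfMap_toRealification_of, rlfMap_toRealification_of,
      h₀.Φ₀_map_eq_of_cnst_map_eq g g' hg x₀ ⟨b, hb, hx₀⟩]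
  cnst_map_eq_of_BΛ_map_eq _ Y g g' hker := by
    refine h₀.cnst_map_eq_of_B₀_map_eq g g' fun b hb => hker b ?_
    change gpMap (((toRlfNatTrans dm.Φ₀ hpf).app (op Y)).hom) (dm.div₀ (op Y) b) = 1
    rw [hb, map_one]

end RealifiedDivisorMonoids.Prop34Cnst

/-! ### Theorem 3.7 (iii) over the constructed data -/

namespace TemperedFrobenioid

variable {D₀ : Type u} [Category.{v} D₀] {dm : DivisorMonoids.{u, v, w} D₀}
  {hpf : ∀ Y : D₀ᵒᵖ, IsPerfFactorial (dm.Φ₀.obj Y)} {V : FrdIMonoidStub.{w}}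
  {V₀ : FrdICatStub.{u, v, w} D₀} {D : Type u₀} [Category.{v₀} D] {VD : FrdICatStub.{u₀, v₀, w} D}
  (C₀ : TemperedFrobenioid (RealifiedDivisorMonoids.ofRlfZ dm hpf) D VD)
  {Dcnst : Type u₁} [Category.{v₁} Dcnst] {cnst : D₀ ⥤ Dcnst}

/-- **Theorem 3.7 (iii) for a tempered Frobenioid (of monoid type `ℤ`) over the CONSTRUCTED Def. 3.6 (i)
data `ofRlfZ dm hpf`**, at the instantiated facade, modulo statements about the Def. 3.3 (iii) data only:
the typed Prop. 3.4 (ii) `dm.Prop34` and its naturality clauses `dm.Prop34Cnst₀ cnst`.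
[cite: MochizukiEtTh2009, Thm 3.7 (iii) p.79] -/
theorem thm37_iii_withCnst_ofRlfZ (F : FrobenioidFacade.{u₀, v₀, w} D) (h34 : dm.Prop34 V V₀)
    (h₀ : dm.Prop34Cnst₀ cnst) : C₀.Thm37_iii (F.withCnst (C₀.base ⋙ cnst)) :=
  C₀.thm37_iii_withCnst F (RealifiedDivisorMonoids.Prop34Cnst.ofRlfZ h34 h₀)

end TemperedFrobenioid

/-! ### Consistency witness at the `B₀`-level -/

namespace Toy

/-- The toy Def. 3.3 (iii) data satisfy `Prop34Cnst₀` (for `cnst := 𝟭`): the `B₀`-level structure is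
jointly satisfiable with the interface stack. [cite: MochizukiEtTh2009, Prop 3.4 (ii) p.74] -/
theorem prop34Cnst₀ : divisorMonoids.Prop34Cnst₀ (𝟭 (Discrete PUnit.{1})) where
  B₀_map_eq_of_cnst_map_eq g g' _ _ _ := by rw [Subsingleton.elim g g']
  Φ₀_map_eq_of_cnst_map_eq g g' _ _ _ := by rw [Subsingleton.elim g g']
  cnst_map_eq_of_B₀_map_eq g g' _ := Subsingleton.elim _ _

end Toy

end Literature.AnabelianGeometry.EtaleTheta

end
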